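import Summits.CriticalPhenomena.PercolationContinuityZ3.Theorems.PercNearOneGluingNoHeavyPcintBondCertZ3K6Defs
import HarnessLib

/-!
# PCINT lane, kernel check 7/8 of the B3r window certificate (`d = 3`, memory 6, `p = 0.2176`): codes `5832 ≤ n < 6804`

Cell `prim-pcint`, seat `prim-pcint-2`. The Collatz–Wielandt rows `10^5 · rowB ≤ 99995 · 2·10^72 · v` for the windows with
base-6 code in `[5832, 6804)`, by `decide +kernel` (natural-number arithmetic only; four chunks of 243 codes — larger
chunks exceed the kernel's recursion budget for these rows — hence `maxHeartbeats 0`). Does NOT build on p205010.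
-/

namespace Summit.CriticalPhenomena.PercolationContinuityZ3.Theorems.Pcint.Z3B6

set_option maxHeartbeats 0 in
/-- Rows `5832 ≤ n < 6075` of the certificate hold. [folklore] -/
theorem checkRangeB_7a : checkRangeB 5832 6075 = true := by decide +kernel

set_option maxHeartbeats 0 in
/-- Rows `6075 ≤ n < 6318` of the certificate hold. [folklore] -/
theorem checkRangeB_7b : checkRangeB 6075 6318 = true := by decide +kernel

set_option maxHeartbeats 0 in
/-- Rows `6318 ≤ n < 6561` of the certificate hold. [folklore] -/
theorem checkRangeB_7c : checkRangeB 6318 6561 = true := by decide +kernel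

set_option maxHeartbeats 0 in
/-- Rows `6561 ≤ n < 6804` of the certificate hold. [folklore] -/
theorem checkRangeB_7d : checkRangeB 6561 6804 = true := by decide +kernel

/-- Rows `5832 ≤ n < 6804` of the certificate hold. [folklore] -/
theorem checkRangeB_7 : checkRangeB 5832 6804 = true :=
  checkRangeB_of_split (checkRangeB_of_split checkRangeB_7a checkRangeB_7b) (checkRangeB_of_split checkRangeB_7c checkRangeB_7d)

end Summit.CriticalPhenomena.PercolationContinuityZ3.Theorems.Pcint.Z3B6
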